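import Literature.Topology.FourManifolds.CircleFamilyCoordinates
import Literature.Topology.FourManifolds.NullImages
import Mathlib.MeasureTheory.Measure.Haar.InnerProductSpace
import Mathlib.Topology.MetricSpace.Thickening
import HarnessLib

/-!
# One-parameter families of circles: the generic perturbation step (Whitney 1936, §§8–9)

Topic `Literature/Topology/FourManifolds`; the inductive step of the general-position argument in
the tree's proof of Whitney's theorem *homotopic smoothly embedded circles in a manifold `V` of
dimension `n ≥ 4` are smoothly isotopic* (leaf
`Literature.Topology.FourManifolds.Milnor1965_isAmbientIsotopic_of_simplyConnected` of
`HCobordismAuxiliaryPair.lean`; H. Whitney, *Differentiable manifolds*, Ann. of Math. 37 (1936),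
§II Thm. 6 and §§8–9; Milnor, *Lectures on the h-cobordism theorem* (1965), Thm. 8.4 and Remark).

**The step** (`Literature.Topology.FourManifolds.exists_chartPerturb_stagesGoodOn`).  Let
`G : ℝ × S¹ → V` be a smooth family whose stages are good on `A`
(`Literature.Topology.FourManifolds.StagesGoodOn n G A`: nonzero θ-velocity at the points of `A`,
and the points of `A` are separated from all other points of their stage), let
`[τ - 3δ, τ + 3δ] × (closed arc of angle 3α about circlePoint c)` be mapped by `G` into the source
of the chart at `x : V` (`0 < δ`, `0 < α`, `3α < π/2`), and let finitely many compact sets `C i`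
be mapped by `G` into open sets `U i`.  Then for a suitable (generic, small) parameter
`q = (v, w) ∈ ℝⁿ × ℝⁿ` the perturbed family
`G' = chartPerturb G x (rectBump τ δ c α) (angSin c) q` (`CircleFamilies.lean`: in the chart at
`x`, `G p` is moved by `ρ p • (v + sin (θ - c) • w)`) is smooth, its stages are good on
`A ∪ [τ - δ, τ + δ] × (closed arc of angle α)`, it still maps each `C i` into `U i`, and it
agrees with `G` wherever the bump vanishes.

**Proof.**  Smallness: `‖v‖ + ‖w‖ < ε` keeps the perturbed coordinates in the chart target and the
perturbed points of `C i` in `U i` (compactness, `IsCompact.exists_cthickening_subset_open`).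
Genericity: the parameters for which some perturbed θ-velocity vanishes, or two perturbed
points of the same stage coincide, at points where the perturbation has a grip, form three null
sets (`NullImages.lean`: `addHaar_setOf_exists_smul_add_smul_eq`, the conditions being affine in
`(v, w)` with coefficients parametrised by `2` resp. `3` real variables, `< n`); a small parameter
off these null sets exists (`exists_mem_notMem_of_measure_zero`).  Where the perturbation has no
grip (`ρ = 0` and `∂_θ ρ = 0`), the perturbed family agrees with `G` to first order and the
hypothesis on `A` applies.  Everything here is proved; no definitions, no named facts.

## References

* H. Whitney, *Differentiable manifolds*, Ann. of Math. (2) 37 (1936), 645–680, §II Thm. 6,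
  §§8–9. [Whitney1936]
* J. Milnor, *Lectures on the h-cobordism theorem* (1965), Thm. 8.4 and Remark (PDF p. 56).
  [MilnorHCobordism1965]
* M. W. Hirsch, *Differential Topology*, GTM 33 (1976), Ch. 3 §2 Thm. 2.5, Ch. 8 §1 Ex. 14.
  [HirschDT1976]
-/

open scoped Manifold ContDiff Topology Real
open Function Set Filter
open _root_.MeasureTheory _root_.MeasureTheory.Measure

noncomputable section

namespace Literature.Topology.FourManifolds

variable {n : ℕ} {V : Type*} [TopologicalSpace V] [ChartedSpace (EuclideanSpace ℝ (Fin n)) V]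

/-! ### The rectangle, its core and the support of the bump -/

section Rectangles

/-- For `0 < α`, `3α < π/2`: the closed arc of angle `2α` lies in the open arc of angle `3α`.
[folklore] -/
theorem circleClosedArc_two_mul_subset {c α : ℝ} (hα : 0 < α) (h3α : 3 * α < π / 2) :
    circleClosedArc c (2 * α) ⊆ circleArc c (3 * α) :=
  circleClosedArc_subset_arc (by linarith) (by linarith) (by linarith [Real.pi_pos])

/-- For `0 < α`, `3α < π/2`: the closed arc of angle `α` lies in the open arc of angle `3α`.
[folklore] -/
theorem circleClosedArc_subset_three_mul {c α : ℝ} (hα : 0 < α) (h3α : 3 * α < π / 2) :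
    circleClosedArc c α ⊆ circleArc c (3 * α) :=
  circleClosedArc_subset_arc hα.le (by linarith) (by linarith [Real.pi_pos])

/-- **Support of the rectangle bump inside the open rectangle**
`(τ - 3δ, τ + 3δ) × circleArc c (3α)`. [folklore] -/
theorem tsupport_rectBump_subset_rect {τ δ c α : ℝ} (hδ : 0 < δ) (hα : 0 < α)
    (h3α : 3 * α < π / 2) :
    tsupport (rectBump τ δ c α) ⊆ Ioo (τ - 3 * δ) (τ + 3 * δ) ×ˢ circleArc c (3 * α) := by
  refine (tsupport_rectBump_subset hδ hα (by linarith [Real.pi_pos])).trans ?_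
  exact prod_mono (Icc_subset_Ioo (by linarith) (by linarith))
    (circleClosedArc_two_mul_subset hα h3α)

/-- The open rectangle lies in the closed rectangle. [folklore] -/
theorem rect_subset_closedRect (τ δ c α : ℝ) :
    Ioo (τ - 3 * δ) (τ + 3 * δ) ×ˢ circleArc c (3 * α) ⊆
      Icc (τ - 3 * δ) (τ + 3 * δ) ×ˢ circleClosedArc c (3 * α) :=
  prod_mono Ioo_subset_Icc_self (circleArc_subset_carc _ _)

/-- The core rectangle `[τ - δ, τ + δ] × circleClosedArc c α` lies in the open rectangle.
[folklore] -/
theorem core_subset_rect {τ δ c α : ℝ} (hδ : 0 < δ) (hα : 0 < α) (h3α : 3 * α < π / 2) :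
    Icc (τ - δ) (τ + δ) ×ˢ circleClosedArc c α ⊆ Ioo (τ - 3 * δ) (τ + 3 * δ) ×ˢ circleArc c (3 * α) :=
  prod_mono (Icc_subset_Ioo (by linarith) (by linarith)) (circleClosedArc_subset_three_mul hα h3α)

/-- The open rectangle is open. [folklore] -/
theorem isOpen_rect (τ δ c α : ℝ) : IsOpen (Ioo (τ - 3 * δ) (τ + 3 * δ) ×ˢ circleArc c (3 * α)) :=
  isOpen_Ioo.prod (isOpen_circleArc _ _)

/-- The closed rectangle is compact. [folklore] -/
theorem isCompact_closedRect (τ δ c α : ℝ) :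
    IsCompact (Icc (τ - 3 * δ) (τ + 3 * δ) ×ˢ circleClosedArc c (3 * α)) :=
  isCompact_Icc.prod (isCompact_circleClosedArc _ _)

/-- The rectangle bump is `1` on the core rectangle. [folklore] -/
theorem rectBump_eq_one_of_mem_core {τ δ c α : ℝ} (hδ : 0 < δ) (hα : 0 < α)
    (h3α : 3 * α < π / 2) {p : ℝ × (Metric.sphere (0 : EuclideanSpace ℝ (Fin 2)) 1)} (hp : p ∈ Icc (τ - δ) (τ + δ) ×ˢ circleClosedArc c α) :
    rectBump τ δ c α p = 1 :=
  rectBump_eq_one hδ hα (by linarith [Real.pi_pos]) hp.1 hp.2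

/-- A point of the open rectangle lifts to the sheet: `u = circlePoint θ` with `|θ - c| < 3α`,
and then `θ - c ∈ (-π/2, π/2)`. [folklore] -/
theorem exists_lift_of_mem_circleArc_three_mul {c α : ℝ} (hα : 0 < α) (h3α : 3 * α < π / 2)
    {u : (Metric.sphere (0 : EuclideanSpace ℝ (Fin 2)) 1)} (hu : u ∈ circleArc c (3 * α)) :
    ∃ θ : ℝ, θ - c ∈ Ioo (-(π / 2)) (π / 2) ∧ circlePoint θ = u := by
  obtain ⟨θ, hθ, rfl⟩ := exists_abs_lt_of_mem_circleArc hu (by linarith)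
  refine ⟨θ, ?_, rfl⟩
  rw [abs_lt] at hθ
  exact ⟨by linarith, by linarith⟩

/-- On the open arc of angle `3α < π/2`, `cos (θ - c) > 0` for every lift `θ`. [folklore] -/
theorem cos_sub_pos_of_circlePoint_mem_circleArc {c α θ : ℝ} (h3α : 3 * α < π / 2)
    (hα : 0 < α) (hθ : circlePoint θ ∈ circleArc c (3 * α)) : 0 < Real.cos (θ - c) := by
  have h := mem_circleArc.1 hθ
  rw [angCos_circlePoint] at h
  have hpos : 0 < Real.cos (3 * α) := Real.cos_pos_of_mem_Ioo ⟨by linarith, h3α⟩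
  linarith

end Rectangles

/-! ### Margins: small perturbations keep compact images inside open sets -/

section Margins

/-- **Margin lemma.**  If `G` is continuous and maps the compact set `C ⊆ ℝ × S¹` into the source
of the chart at `x`, and the chart images `φ (G '' C)` lie in the open set `O ⊆ ℝⁿ`, then all
`y`-translates with `‖y‖ ≤ ε` of these images still lie in `O`, for some `ε > 0`
(`IsCompact.exists_cthickening_subset_open`). [folklore] -/
theorem exists_pos_forall_add_mem {G : ℝ × (Metric.sphere (0 : EuclideanSpace ℝ (Fin 2)) 1) → V} (hG : Continuous G) {x : V}
    {C : Set (ℝ × (Metric.sphere (0 : EuclideanSpace ℝ (Fin 2)) 1))} (hC : IsCompact C) (hsrc : MapsTo G C (chartAt (EuclideanSpace ℝ (Fin n)) x).source)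
    {O : Set (EuclideanSpace ℝ (Fin n))} (hO : IsOpen O) (hCO : ∀ p ∈ C, extChartAt (𝓡 n) x (G p) ∈ O) :
    ∃ ε : ℝ, 0 < ε ∧ ∀ p ∈ C, ∀ y : EuclideanSpace ℝ (Fin n), ‖y‖ ≤ ε → extChartAt (𝓡 n) x (G p) + y ∈ O := by
  set S : Set (EuclideanSpace ℝ (Fin n)) := (fun p => extChartAt (𝓡 n) x (G p)) '' C with hS
  have hcont : ContinuousOn (fun p => extChartAt (𝓡 n) x (G p)) C := by
    refine (continuousOn_extChartAt x).comp hG.continuousOn ?_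
    intro p hp
    rw [extChartAt_source]
    exact hsrc hp
  have hSc : IsCompact S := hC.image_of_continuousOn hcont
  have hSO : S ⊆ O := by
    rintro _ ⟨p, hp, rfl⟩
    exact hCO p hp
  obtain ⟨ε, hε, hεO⟩ := hSc.exists_cthickening_subset_open hO hSO
  refine ⟨ε, hε, fun p hp y hy => hεO ?_⟩
  refine Metric.mem_cthickening_of_dist_le _ (extChartAt (𝓡 n) x (G p)) _ _ ⟨p, hp, rfl⟩ ?_
  simpa [dist_eq_norm] using hy

end Margins

/-! ### Elementary estimates and identities for the affine term -/

section Affine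

/-- `‖ρ • (v + ℓ • w)‖ ≤ ‖v‖ + ‖w‖` for `|ρ| ≤ 1`, `|ℓ| ≤ 1`. [folklore] -/
theorem norm_smul_add_smul_le {F : Type*} [NormedAddCommGroup F] [NormedSpace ℝ F] {ρ ℓ : ℝ}
    (hρ : |ρ| ≤ 1) (hℓ : |ℓ| ≤ 1) (v w : F) : ‖ρ • (v + ℓ • w)‖ ≤ ‖v‖ + ‖w‖ := by
  calc ‖ρ • (v + ℓ • w)‖ = |ρ| * ‖v + ℓ • w‖ := by rw [norm_smul, Real.norm_eq_abs]
    _ ≤ 1 * ‖v + ℓ • w‖ := by gcongr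
    _ = ‖v + ℓ • w‖ := one_mul _
    _ ≤ ‖v‖ + ‖ℓ • w‖ := norm_add_le _ _
    _ = ‖v‖ + |ℓ| * ‖w‖ := by rw [norm_smul, Real.norm_eq_abs]
    _ ≤ ‖v‖ + 1 * ‖w‖ := by gcongr
    _ = ‖v‖ + ‖w‖ := by rw [one_mul]

/-- **Two-point identity.**  From `g + ρ • (v + ℓ • w) = g' + ρ' • (v + ℓ' • w)` follows
`(ρ - ρ') • v + (ρ ℓ - ρ' ℓ') • w = g' - g`. [folklore] -/
theorem sub_smul_add_sub_smul_eq {F : Type*} [AddCommGroup F] [Module ℝ F] {g g' v w : F}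
    {ρ ρ' ℓ ℓ' : ℝ} (h : g + ρ • (v + ℓ • w) = g' + ρ' • (v + ℓ' • w)) :
    (ρ - ρ') • v + (ρ * ℓ - ρ' * ℓ') • w = g' - g := by
  have h' : ρ • (v + ℓ • w) - ρ' • (v + ℓ' • w) = g' - g := by
    rw [sub_eq_sub_iff_add_eq_add, add_comm, h, add_comm]
  rw [← h', sub_smul, sub_smul, smul_add, smul_add, smul_smul, smul_smul]
  abel

/-- **One-point identity.**  From `g + ρ • (v + ℓ • w) = g'` follows `ρ • v + (ρ ℓ) • w = g' - g`.
[folklore] -/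
theorem smul_add_smul_eq_sub {F : Type*} [AddCommGroup F] [Module ℝ F] {g g' v w : F}
    {ρ ℓ : ℝ} (h : g + ρ • (v + ℓ • w) = g') : ρ • v + (ρ * ℓ) • w = g' - g := by
  rw [← h, smul_add, smul_smul]
  abel

end Affine

/-! ### The lifted sine coordinate -/

section Sine

/-- The lift of `angSin c` along `circlePoint` is `θ ↦ sin (θ - c)`. [folklore] -/
theorem angSin_lift_eq (c : ℝ) :
    (fun z : ℝ × ℝ => angSin c (circlePoint z.2)) = fun z : ℝ × ℝ => Real.sin (z.2 - c) := by
  funext z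
  exact angSin_circlePoint c z.2

/-- The lifted sine coordinate is smooth with `∂_θ` equal to `cos (θ - c)`. [folklore] -/
theorem hasFDerivAt_angSin_lift (c : ℝ) (z : ℝ × ℝ) :
    HasFDerivAt (fun z : ℝ × ℝ => angSin c (circlePoint z.2))
      (Real.cos (z.2 - c) • ((ContinuousLinearMap.snd ℝ ℝ ℝ))) z := by
  rw [angSin_lift_eq]
  have h1 : HasFDerivAt (fun z : ℝ × ℝ => z.2 - c) (ContinuousLinearMap.snd ℝ ℝ ℝ) z :=
    (hasFDerivAt_snd (𝕜 := ℝ) (p := z)).sub_const c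
  exact (Real.hasDerivAt_sin (z.2 - c)).comp_hasFDerivAt z h1

/-- The lifted sine coordinate is differentiable. [folklore] -/
theorem differentiable_angSin_lift (c : ℝ) :
    Differentiable ℝ (fun z : ℝ × ℝ => angSin c (circlePoint z.2)) := fun z =>
  (hasFDerivAt_angSin_lift c z).differentiableAt

/-- `∂_θ` of the lifted sine coordinate is `cos (θ - c)`. [folklore] -/
theorem fderiv_angSin_lift_apply (c : ℝ) (z : ℝ × ℝ) :
    fderiv ℝ (fun z : ℝ × ℝ => angSin c (circlePoint z.2)) z (0, 1) = Real.cos (z.2 - c) := by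
  rw [(hasFDerivAt_angSin_lift c z).fderiv]
  simp

/-- The lifted sine coordinate is `C^∞`. [folklore] -/
theorem contDiff_angSin_lift (c : ℝ) :
    ContDiff ℝ ∞ (fun z : ℝ × ℝ => angSin c (circlePoint z.2)) := by
  rw [angSin_lift_eq]
  exact Real.contDiff_sin.comp (contDiff_snd.sub contDiff_const)

/-- **Injectivity of the sine coordinate on the sheet**: lifts `θ`, `θ'` with
`θ - c, θ' - c ∈ (-π/2, π/2)` and `sin (θ - c) = sin (θ' - c)` are equal. [folklore] -/
theorem eq_of_sin_sub_eq {c θ θ' : ℝ} (hθ : θ - c ∈ Ioo (-(π / 2)) (π / 2))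
    (hθ' : θ' - c ∈ Ioo (-(π / 2)) (π / 2)) (h : Real.sin (θ - c) = Real.sin (θ' - c)) :
    θ = θ' := by
  have := Real.injOn_sin (Ioo_subset_Icc_self hθ) (Ioo_subset_Icc_self hθ') h
  linarith

end Sine

/-! ### The generic step -/

section Step

variable [IsManifold (𝓡 n) ∞ V]

/-- **The generic perturbation step** (Whitney (1936), §§8–9, for one-parameter families of
circles; Hirsch (1976), Ch. 3 §2 Thm. 2.5).  Let `n ≥ 4`, `G : ℝ × S¹ → V` a smooth family whose
stages are good on `A` (`StagesGoodOn n G A`), `[τ - 3δ, τ + 3δ] × circleClosedArc c (3α)` mapped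
by `G` into the source of the chart at `x` (`0 < δ`, `0 < α`, `3α < π/2`), and finitely many
compact sets `C i ⊆ ℝ × S¹` mapped by `G` into open sets `U i ⊆ V`.  Then for some parameter
`q ∈ ℝⁿ × ℝⁿ` the perturbed family `G' = chartPerturb G x (rectBump τ δ c α) (angSin c) q` is
smooth, its stages are good on `A ∪ [τ - δ, τ + δ] × circleClosedArc c α`, it maps each `C i`
into `U i`, and it agrees with `G` wherever the bump `rectBump τ δ c α` vanishes.
[cite: Whitney1936, §II Thm. 6 and §§8–9] -/
theorem exists_chartPerturb_stagesGoodOn (hn : 4 ≤ n) {G : ℝ × (Metric.sphere (0 : EuclideanSpace ℝ (Fin 2)) 1) → V}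
    (hG : ContMDiff (𝓘(ℝ, ℝ).prod (𝓡 1)) (𝓡 n) ∞ G) {A : Set (ℝ × (Metric.sphere (0 : EuclideanSpace ℝ (Fin 2)) 1))}
    (hA : StagesGoodOn n G A) {τ δ c α : ℝ} (hδ : 0 < δ) (hα : 0 < α) (h3α : 3 * α < π / 2)
    {x : V} (hRc : MapsTo G (Icc (τ - 3 * δ) (τ + 3 * δ) ×ˢ circleClosedArc c (3 * α))
      (chartAt (EuclideanSpace ℝ (Fin n)) x).source)
    {ι : Type*} [Finite ι] {C : ι → Set (ℝ × (Metric.sphere (0 : EuclideanSpace ℝ (Fin 2)) 1))} {U : ι → Set V} (hC : ∀ i, IsCompact (C i))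
    (hU : ∀ i, IsOpen (U i)) (hCU : ∀ i, MapsTo G (C i) (U i)) :
    ∃ q : EuclideanSpace ℝ (Fin n) × EuclideanSpace ℝ (Fin n),
      ContMDiff (𝓘(ℝ, ℝ).prod (𝓡 1)) (𝓡 n) ∞ (chartPerturb G x (rectBump τ δ c α) (angSin c) q) ∧
      StagesGoodOn n (chartPerturb G x (rectBump τ δ c α) (angSin c) q)
        (A ∪ Icc (τ - δ) (τ + δ) ×ˢ circleClosedArc c α) ∧
      (∀ i, MapsTo (chartPerturb G x (rectBump τ δ c α) (angSin c) q) (C i) (U i)) ∧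
      ∀ p, rectBump τ δ c α p = 0 → chartPerturb G x (rectBump τ δ c α) (angSin c) q p = G p := by
  -- ### the bump, the coordinate, the rectangles
  set ρ : ℝ × (Metric.sphere (0 : EuclideanSpace ℝ (Fin 2)) 1) → ℝ := rectBump τ δ c α with hρdef
  set ℓ : (Metric.sphere (0 : EuclideanSpace ℝ (Fin 2)) 1) → ℝ := angSin c with hℓdef
  set R : Set (ℝ × (Metric.sphere (0 : EuclideanSpace ℝ (Fin 2)) 1)) := Ioo (τ - 3 * δ) (τ + 3 * δ) ×ˢ circleArc c (3 * α) with hRdef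
  set Rc : Set (ℝ × (Metric.sphere (0 : EuclideanSpace ℝ (Fin 2)) 1)) := Icc (τ - 3 * δ) (τ + 3 * δ) ×ˢ circleClosedArc c (3 * α) with hRcdef
  set K : Set (ℝ × (Metric.sphere (0 : EuclideanSpace ℝ (Fin 2)) 1)) := Icc (τ - δ) (τ + δ) ×ˢ circleClosedArc c α with hKdef
  have hρs : ContMDiff (𝓘(ℝ, ℝ).prod (𝓡 1)) 𝓘(ℝ, ℝ) ∞ ρ := contMDiff_rectBump τ δ c α
  have hℓs : ContMDiff (𝓡 1) 𝓘(ℝ, ℝ) ∞ ℓ := contMDiff_angSin c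
  have hRo : IsOpen R := isOpen_rect τ δ c α
  have hsuppR : tsupport ρ ⊆ R := tsupport_rectBump_subset_rect hδ hα h3α
  have hRRc : R ⊆ Rc := rect_subset_closedRect τ δ c α
  have hKR : K ⊆ R := core_subset_rect hδ hα h3α
  have hsrcR : MapsTo G R (chartAt (EuclideanSpace ℝ (Fin n)) x).source := fun p hp => hRc (hRRc hp)
  have hρK : ∀ p ∈ K, ρ p = 1 := fun p hp => rectBump_eq_one_of_mem_core hδ hα h3α hp
  have hρ0 : ∀ p, p ∉ R → ρ p = 0 := fun p hp => by
    by_contra h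
    exact hp (hsuppR (subset_tsupport _ (mem_support.2 h)))
  have habsρ : ∀ p, |ρ p| ≤ 1 := fun p => abs_rectBump_le_one τ δ c α p
  have habsℓ : ∀ u, |ℓ u| ≤ 1 := fun u => abs_angSin_le_one c u
  have hnotK : ∀ p, ρ p = 0 → p ∉ K := fun p h hK => by
    have := hρK p hK
    rw [h] at this
    exact zero_ne_one this
  have hmemA : ∀ p, p ∈ A ∪ K → ρ p = 0 → p ∈ A := fun p hp h =>
    hp.resolve_right (hnotK p h)
  -- ### margins
  obtain ⟨ε₀, hε₀, hε₀P⟩ := exists_pos_forall_add_mem hG.continuous (isCompact_closedRect τ δ c α)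
    hRc (isOpen_extChartAt_target (I := 𝓡 n) x) fun p hp =>
      (extChartAt (𝓡 n) x).map_source (by rw [extChartAt_source]; exact hRc hp)
  have hεi : ∀ i, ∃ ε : ℝ, 0 < ε ∧ ∀ p ∈ C i ∩ Rc, ∀ y : EuclideanSpace ℝ (Fin n), ‖y‖ ≤ ε →
      extChartAt (𝓡 n) x (G p) + y ∈
        (extChartAt (𝓡 n) x).target ∩ (extChartAt (𝓡 n) x).symm ⁻¹' U i := by
    intro i
    refine exists_pos_forall_add_mem hG.continuous
      ((hC i).inter_right (isCompact_closedRect τ δ c α).isClosed) (fun p hp => hRc hp.2)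
      ((continuousOn_extChartAt_symm x).isOpen_inter_preimage (isOpen_extChartAt_target x) (hU i))
      fun p hp => ⟨(extChartAt (𝓡 n) x).map_source (by rw [extChartAt_source]; exact hRc hp.2), ?_⟩
    rw [mem_preimage, (extChartAt (𝓡 n) x).left_inv (by rw [extChartAt_source]; exact hRc hp.2)]
    exact hCU i hp.1
  choose εi hεi_pos hεiP using hεi
  obtain ⟨ε, ⟨hεle0, hεlei⟩, hεpos⟩ : ∃ ε : ℝ, (ε ≤ ε₀ ∧ ∀ i, ε ≤ εi i) ∧ 0 < ε := by
    have h1 : ∀ᶠ ε in 𝓝[>] (0 : ℝ), ε ≤ ε₀ := by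
      filter_upwards [Ioc_mem_nhdsGT hε₀] with ε hε using hε.2
    have h2 : ∀ᶠ ε in 𝓝[>] (0 : ℝ), ∀ i, ε ≤ εi i :=
      eventually_all.2 fun i => by
        filter_upwards [Ioc_mem_nhdsGT (hεi_pos i)] with ε hε using hε.2
    exact ((h1.and h2).and self_mem_nhdsWithin).exists
  -- ### lifted functions and coefficient functions
  set gL : ℝ × ℝ → EuclideanSpace ℝ (Fin n) := fun z => extChartAt (𝓡 n) x (G (z.1, circlePoint z.2)) with hgLdef
  set ρL : ℝ × ℝ → ℝ := fun z => ρ (z.1, circlePoint z.2) with hρLdef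
  set ℓL : ℝ × ℝ → ℝ := fun z => ℓ (circlePoint z.2) with hℓLdef
  set PA : Set (ℝ × ℝ) := {z | ((z.1, circlePoint z.2) : ℝ × (Metric.sphere (0 : EuclideanSpace ℝ (Fin 2)) 1)) ∈ R} with hPAdef
  set SL : Set (ℝ × ℝ) := {z | G (z.1, circlePoint z.2) ∈ (chartAt (EuclideanSpace ℝ (Fin n)) x).source} with hSLdef
  have hPASL : PA ⊆ SL := fun z hz => hsrcR hz
  have hρLd : ContDiff ℝ ∞ ρL := contDiff_rectBump_lift τ δ c α
  have hℓLd : ContDiff ℝ ∞ ℓL := contDiff_angSin_lift c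
  have hℓL_apply : ∀ z : ℝ × ℝ, ℓL z = Real.sin (z.2 - c) := fun z => angSin_circlePoint c z.2
  have hDℓL : ∀ z : ℝ × ℝ, fderiv ℝ ℓL z (0, 1) = Real.cos (z.2 - c) := fderiv_angSin_lift_apply c
  have hgLd : ContDiffOn ℝ ∞ gL SL := contDiffOn_extChartAt_lift hG x
  have hDgLd : ContDiffOn ℝ ∞ (fun z => fderiv ℝ gL z (0, 1)) SL :=
    contDiffOn_fderiv_extChartAt_lift hG x
  set aF : ℝ × ℝ → ℝ := fun z => fderiv ℝ ρL z (0, 1) with haFdef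
  set bF : ℝ × ℝ → ℝ := fun z => fderiv ℝ ρL z (0, 1) * ℓL z + ρL z * fderiv ℝ ℓL z (0, 1)
    with hbFdef
  have hDρd : Differentiable ℝ fun z : ℝ × ℝ => fderiv ℝ ρL z (0, 1) :=
    ((hρLd.fderiv_right (m := ∞) (by simp)).clm_apply contDiff_const).differentiable (by simp)
  have hDℓd : Differentiable ℝ fun z : ℝ × ℝ => fderiv ℝ ℓL z (0, 1) :=
    ((hℓLd.fderiv_right (m := ∞) (by simp)).clm_apply contDiff_const).differentiable (by simp)
  have hρd : Differentiable ℝ ρL := hρLd.differentiable (by simp)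
  have hℓd : Differentiable ℝ ℓL := hℓLd.differentiable (by simp)
  have haFd : Differentiable ℝ aF := hDρd
  have hbFd : Differentiable ℝ bF := (hDρd.mul hℓd).add (hρd.mul hDℓd)
  have hgd : DifferentiableOn ℝ gL SL := hgLd.differentiableOn (by simp)
  have hDgd : DifferentiableOn ℝ (fun z => fderiv ℝ gL z (0, 1)) SL :=
    hDgLd.differentiableOn (by simp)
  -- ### the three null sets
  set μ : Measure (EuclideanSpace ℝ (Fin n) × EuclideanSpace ℝ (Fin n)) := (volume : Measure (EuclideanSpace ℝ (Fin n))).prod volume with hμ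
  have hdim2 : Module.finrank ℝ (ℝ × ℝ) < Module.finrank ℝ (EuclideanSpace ℝ (Fin n)) := by
    rw [Module.finrank_prod, Module.finrank_self, finrank_euclideanSpace_fin]
    omega
  have hdim3 : Module.finrank ℝ ((ℝ × ℝ) × ℝ) < Module.finrank ℝ (EuclideanSpace ℝ (Fin n)) := by
    rw [Module.finrank_prod, Module.finrank_prod, Module.finrank_self, finrank_euclideanSpace_fin]
    omega
  -- (A) vanishing θ-velocity where the perturbation has a grip
  set BadA : Set (EuclideanSpace ℝ (Fin n) × EuclideanSpace ℝ (Fin n)) := {q | ∃ z ∈ PA, (aF z ≠ 0 ∨ bF z ≠ 0) ∧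
    aF z • q.1 + bF z • q.2 = -(fderiv ℝ gL z (0, 1))} with hBadA
  have hBadA0 : μ BadA = 0 :=
    addHaar_setOf_exists_smul_add_smul_eq μ hdim2 haFd.differentiableOn hbFd.differentiableOn
      ((hDgd.mono hPASL).neg)
  -- (B) coincidences of two perturbed points of the rectangle
  set PB : Set ((ℝ × ℝ) × ℝ) := {zz | zz.1 ∈ PA ∧ ((zz.1.1, zz.2) : ℝ × ℝ) ∈ PA} with hPBdef
  set sh : (ℝ × ℝ) × ℝ → ℝ × ℝ := fun zz => (zz.1.1, zz.2) with hshdef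
  have hshd : Differentiable ℝ sh :=
    (differentiable_fst.comp differentiable_fst).prodMk differentiable_snd
  set BadB : Set (EuclideanSpace ℝ (Fin n) × EuclideanSpace ℝ (Fin n)) := {q | ∃ zz ∈ PB,
    (ρL zz.1 - ρL (sh zz) ≠ 0 ∨ ρL zz.1 * ℓL zz.1 - ρL (sh zz) * ℓL (sh zz) ≠ 0) ∧
      (ρL zz.1 - ρL (sh zz)) • q.1 + (ρL zz.1 * ℓL zz.1 - ρL (sh zz) * ℓL (sh zz)) • q.2 =
        gL (sh zz) - gL zz.1} with hBadB
  have hBadB0 : μ BadB = 0 := by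
    refine addHaar_setOf_exists_smul_add_smul_eq μ hdim3 ?_ ?_ ?_
    · exact ((hρd.comp differentiable_fst).sub (hρd.comp hshd)).differentiableOn
    · exact (((hρd.comp differentiable_fst).mul (hℓd.comp differentiable_fst)).sub
        ((hρd.comp hshd).mul (hℓd.comp hshd))).differentiableOn
    · exact (hgd.comp hshd.differentiableOn fun zz hzz => hPASL hzz.2).sub
        (hgd.comp differentiableOn_fst fun zz hzz => hPASL hzz.1)
  -- (C) coincidence of a perturbed point of the rectangle with another point of the stage
  set PC : Set ((ℝ × ℝ) × ℝ) := {zz | zz.1 ∈ PA ∧ sh zz ∈ SL} with hPCdef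
  set BadC : Set (EuclideanSpace ℝ (Fin n) × EuclideanSpace ℝ (Fin n)) := {q | ∃ zz ∈ PC, (ρL zz.1 ≠ 0 ∨ ρL zz.1 * ℓL zz.1 ≠ 0) ∧
    ρL zz.1 • q.1 + (ρL zz.1 * ℓL zz.1) • q.2 = gL (sh zz) - gL zz.1} with hBadC
  have hBadC0 : μ BadC = 0 := by
    refine addHaar_setOf_exists_smul_add_smul_eq μ hdim3 ?_ ?_ ?_
    · exact (hρd.comp differentiable_fst).differentiableOn
    · exact ((hρd.comp differentiable_fst).mul (hℓd.comp differentiable_fst)).differentiableOn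
    · exact (hgd.comp hshd.differentiableOn fun zz hzz => hzz.2).sub
        (hgd.comp differentiableOn_fst fun zz hzz => hPASL hzz.1)
  -- ### choice of the parameter
  set O : Set (EuclideanSpace ℝ (Fin n) × EuclideanSpace ℝ (Fin n)) := {q | ‖q.1‖ + ‖q.2‖ < ε} with hOdef
  have hOo : IsOpen O := isOpen_lt (continuous_fst.norm.add continuous_snd.norm) continuous_const
  have h0O : (0 : EuclideanSpace ℝ (Fin n) × EuclideanSpace ℝ (Fin n)) ∈ O := by
    simp only [hOdef, mem_setOf_eq, Prod.fst_zero, Prod.snd_zero, norm_zero, add_zero]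
    exact hεpos
  obtain ⟨q, hqO, hqBad⟩ := exists_mem_notMem_of_measure_zero μ hOo ⟨0, h0O⟩
    (measure_union_null (measure_union_null hBadA0 hBadB0) hBadC0)
  refine ⟨q, ?_⟩
  -- ### smallness consequences
  have hsmall : ∀ p : ℝ × (Metric.sphere (0 : EuclideanSpace ℝ (Fin 2)) 1), ‖ρ p • (q.1 + ℓ p.2 • q.2)‖ ≤ ε := fun p =>
    (norm_smul_add_smul_le (habsρ p) (habsℓ p.2) _ _).trans hqO.le
  have htgtRc : ∀ p ∈ Rc, extChartAt (𝓡 n) x (G p) + ρ p • (q.1 + ℓ p.2 • q.2) ∈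
      (extChartAt (𝓡 n) x).target := fun p hp =>
    hε₀P p hp _ ((hsmall p).trans hεle0)
  have htgt : ∀ p ∈ R, extChartAt (𝓡 n) x (G p) + ρ p • (q.1 + ℓ p.2 • q.2) ∈
      (extChartAt (𝓡 n) x).target := fun p hp => htgtRc p (hRRc hp)
  set G' : ℝ × (Metric.sphere (0 : EuclideanSpace ℝ (Fin 2)) 1) → V := chartPerturb G x ρ ℓ q with hG'def
  have hG's : ContMDiff (𝓘(ℝ, ℝ).prod (𝓡 1)) (𝓡 n) ∞ G' :=
    contMDiff_chartPerturb hG hρs hℓs hRo hsuppR hsrcR htgt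
  have hG'R : ∀ p ∈ R, G' p ∈ (chartAt (EuclideanSpace ℝ (Fin n)) x).source ∧
      extChartAt (𝓡 n) x (G' p) = extChartAt (𝓡 n) x (G p) + ρ p • (q.1 + ℓ p.2 • q.2) :=
    fun p hp => chartPerturb_mem_source (hsrcR hp) (htgt p hp)
  have hG'off : ∀ p, p ∉ R → G' p = G p := fun p hp => chartPerturb_of_eq_zero (hρ0 p hp)
  have hcoordL : ∀ z ∈ PA, extChartAt (𝓡 n) x (G' (z.1, circlePoint z.2)) =
      gL z + ρL z • (q.1 + ℓL z • q.2) := fun z hz => (hG'R _ hz).2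
  refine ⟨hG's, ⟨?_, ?_⟩, ?_, fun p hp => chartPerturb_of_eq_zero hp⟩
  · -- ### nonvanishing θ-velocity on `A ∪ K`
    intro t s hts
    by_cases hpR : ((t, circlePoint s) : ℝ × (Metric.sphere (0 : EuclideanSpace ℝ (Fin 2)) 1)) ∈ R
    · have hz : ((t, s) : ℝ × ℝ) ∈ PA := hpR
      have key := thetaVel_chartPerturb_eq_zero_iff hG hρs hℓs hRo hsuppR hsrcR htgt
        (z := (t, s)) hpR
      have hpt : fderiv ℝ (fun z : ℝ × ℝ => ρ (z.1, circlePoint z.2) •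
          (q.1 + ℓ (circlePoint z.2) • q.2)) (t, s) (0, 1) = aF (t, s) • q.1 + bF (t, s) • q.2 :=
        fderiv_smul_add_smul_apply (hρd (t, s)) (hℓd (t, s)) q.1 q.2 (0, 1)
      intro h0
      have h1 : fderiv ℝ gL (t, s) (0, 1) + (aF (t, s) • q.1 + bF (t, s) • q.2) = 0 := by
        rw [← hpt]
        exact key.1 h0
      by_cases hgrip : aF (t, s) ≠ 0 ∨ bF (t, s) ≠ 0
      · exact hqBad (Or.inl (Or.inl ⟨(t, s), hz, hgrip, eq_neg_of_add_eq_zero_right h1⟩))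
      · rw [not_or, not_not, not_not] at hgrip
        obtain ⟨ha0, hb0⟩ := hgrip
        have hcos : 0 < Real.cos (s - c) := cos_sub_pos_of_circlePoint_mem_circleArc h3α hα hpR.2
        have hρz : ρL (t, s) = 0 := by
          have hb : fderiv ℝ ρL (t, s) (0, 1) * ℓL (t, s) + ρL (t, s) * fderiv ℝ ℓL (t, s) (0, 1)
              = 0 := hb0
          have ha : fderiv ℝ ρL (t, s) (0, 1) = 0 := ha0
          rw [ha, zero_mul, zero_add, hDℓL] at hb
          exact (mul_eq_zero.1 hb).resolve_right hcos.ne'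
        have hpA : ((t, circlePoint s) : ℝ × (Metric.sphere (0 : EuclideanSpace ℝ (Fin 2)) 1)) ∈ A := hmemA _ hts hρz
        refine hA.1 t s hpA ((thetaVel_eq_zero_iff_fderiv_lift_eq_zero hG (z := (t, s))
          (hsrcR hpR)).2 ?_)
        have ha : aF (t, s) = 0 := ha0
        have hb : bF (t, s) = 0 := hb0
        rw [ha, hb, zero_smul, zero_smul, add_zero, add_zero] at h1
        exact h1
    · have hev : G' =ᶠ[𝓝 ((t, circlePoint s) : ℝ × (Metric.sphere (0 : EuclideanSpace ℝ (Fin 2)) 1))] G :=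
        chartPerturb_eventuallyEq fun h => hpR (hsuppR h)
      rw [thetaVel_congr_of_eventuallyEq hev]
      exact hA.1 t s (hmemA _ hts (hρ0 _ hpR))
  · -- ### separation of the points of `A ∪ K`
    intro t u u' hp heq
    by_contra hne
    have fallback : ρ (t, u) = 0 → G' (t, u') = G (t, u') → False := fun h0 h1 => by
      have hGeq : G (t, u) = G (t, u') := by
        rw [← chartPerturb_of_eq_zero (G := G) (x := x) (ℓ := ℓ) (q := q) h0, ← h1]
        exact heq
      exact hne (hA.2 t u u' (hmemA _ hp h0) hGeq)
    by_cases hpR : ((t, u) : ℝ × (Metric.sphere (0 : EuclideanSpace ℝ (Fin 2)) 1)) ∈ R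
    · obtain ⟨θ, hθI, hθu⟩ := exists_lift_of_mem_circleArc_three_mul hα h3α (u := u) hpR.2
      have hz : ((t, θ) : ℝ × ℝ) ∈ PA := by
        change ((t, circlePoint θ) : ℝ × (Metric.sphere (0 : EuclideanSpace ℝ (Fin 2)) 1)) ∈ R
        rw [hθu]; exact hpR
      have hρu : ρ (t, u) = ρL (t, θ) := by
        change ρ (t, u) = ρ (t, circlePoint θ)
        rw [hθu]
      by_cases hp'R : ((t, u') : ℝ × (Metric.sphere (0 : EuclideanSpace ℝ (Fin 2)) 1)) ∈ R
      · obtain ⟨θ', hθ'I, hθ'u⟩ := exists_lift_of_mem_circleArc_three_mul hα h3α (u := u') hp'R.2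
        have hz' : ((t, θ') : ℝ × ℝ) ∈ PA := by
          change ((t, circlePoint θ') : ℝ × (Metric.sphere (0 : EuclideanSpace ℝ (Fin 2)) 1)) ∈ R
          rw [hθ'u]; exact hp'R
        have hρu' : ρ (t, u') = ρL (t, θ') := by
          change ρ (t, u') = ρ (t, circlePoint θ')
          rw [hθ'u]
        have hθθ' : θ ≠ θ' := fun h => hne (by rw [← hθu, ← hθ'u, h])
        have hE : gL (t, θ) + ρL (t, θ) • (q.1 + ℓL (t, θ) • q.2) =
            gL (t, θ') + ρL (t, θ') • (q.1 + ℓL (t, θ') • q.2) := by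
          rw [← hcoordL _ hz, ← hcoordL _ hz']
          change extChartAt (𝓡 n) x (G' (t, circlePoint θ)) =
            extChartAt (𝓡 n) x (G' (t, circlePoint θ'))
          rw [hθu, hθ'u, heq]
        have hE2 := sub_smul_add_sub_smul_eq hE
        by_cases hgrip : ρL (t, θ) - ρL (t, θ') ≠ 0 ∨
            ρL (t, θ) * ℓL (t, θ) - ρL (t, θ') * ℓL (t, θ') ≠ 0
        · exact hqBad (Or.inl (Or.inr ⟨((t, θ), θ'), ⟨hz, hz'⟩, hgrip, hE2⟩))
        · rw [not_or, not_not, not_not, sub_eq_zero, sub_eq_zero] at hgrip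
          obtain ⟨h1, h2⟩ := hgrip
          have hρz : ρL (t, θ) = 0 := by
            by_contra hρne
            rw [← h1] at h2
            have hℓeq : ℓL (t, θ) = ℓL (t, θ') := mul_left_cancel₀ hρne h2
            rw [hℓL_apply, hℓL_apply] at hℓeq
            exact hθθ' (eq_of_sin_sub_eq hθI hθ'I hℓeq)
          have hρz' : ρL (t, θ') = 0 := h1 ▸ hρz
          exact fallback (hρu.trans hρz) (chartPerturb_of_eq_zero (hρu'.trans hρz'))
      · have hG'p' : G' (t, u') = G (t, u') := hG'off _ hp'R
        by_cases hsrc' : G (t, u') ∈ (chartAt (EuclideanSpace ℝ (Fin n)) x).source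
        · obtain ⟨θ'', hθ''⟩ := circlePoint_surjective u'
          have hzz : (((t, θ), θ'') : (ℝ × ℝ) × ℝ) ∈ PC := by
            refine ⟨hz, ?_⟩
            change G (t, circlePoint θ'') ∈ (chartAt (EuclideanSpace ℝ (Fin n)) x).source
            rw [hθ'']; exact hsrc'
          have hE : gL (t, θ) + ρL (t, θ) • (q.1 + ℓL (t, θ) • q.2) = gL (t, θ'') := by
            rw [← hcoordL _ hz]
            change extChartAt (𝓡 n) x (G' (t, circlePoint θ)) =
              extChartAt (𝓡 n) x (G (t, circlePoint θ''))
            rw [hθu, hθ'', heq, hG'p']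
          have hE2 := smul_add_smul_eq_sub hE
          by_cases hρne : ρL (t, θ) ≠ 0
          · exact hqBad (Or.inr ⟨((t, θ), θ''), hzz, Or.inl hρne, hE2⟩)
          · rw [not_not] at hρne
            exact fallback (hρu.trans hρne) hG'p'
        · refine hsrc' ?_
          rw [← hG'p', ← heq]
          exact (hG'R _ hpR).1
    · have hρu : ρ (t, u) = 0 := hρ0 _ hpR
      have hG'p : G' (t, u) = G (t, u) := hG'off _ hpR
      by_cases hp'R : ((t, u') : ℝ × (Metric.sphere (0 : EuclideanSpace ℝ (Fin 2)) 1)) ∈ R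
      · by_cases hsrc : G (t, u) ∈ (chartAt (EuclideanSpace ℝ (Fin n)) x).source
        · obtain ⟨θ', hθ'I, hθ'u⟩ := exists_lift_of_mem_circleArc_three_mul hα h3α (u := u') hp'R.2
          have hz' : ((t, θ') : ℝ × ℝ) ∈ PA := by
            change ((t, circlePoint θ') : ℝ × (Metric.sphere (0 : EuclideanSpace ℝ (Fin 2)) 1)) ∈ R
            rw [hθ'u]; exact hp'R
          have hρu' : ρ (t, u') = ρL (t, θ') := by
            change ρ (t, u') = ρ (t, circlePoint θ')
            rw [hθ'u]
          obtain ⟨θ'', hθ''⟩ := circlePoint_surjective u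
          have hzz : (((t, θ'), θ'') : (ℝ × ℝ) × ℝ) ∈ PC := by
            refine ⟨hz', ?_⟩
            change G (t, circlePoint θ'') ∈ (chartAt (EuclideanSpace ℝ (Fin n)) x).source
            rw [hθ'']; exact hsrc
          have hE : gL (t, θ') + ρL (t, θ') • (q.1 + ℓL (t, θ') • q.2) = gL (t, θ'') := by
            rw [← hcoordL _ hz']
            change extChartAt (𝓡 n) x (G' (t, circlePoint θ')) =
              extChartAt (𝓡 n) x (G (t, circlePoint θ''))
            rw [hθ'u, hθ'', ← heq, hG'p]
          have hE2 := smul_add_smul_eq_sub hE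
          by_cases hρne : ρL (t, θ') ≠ 0
          · exact hqBad (Or.inr ⟨((t, θ'), θ''), hzz, Or.inl hρne, hE2⟩)
          · rw [not_not] at hρne
            exact fallback hρu (chartPerturb_of_eq_zero (hρu'.trans hρne))
        · refine hsrc ?_
          rw [← hG'p, heq]
          exact (hG'R _ hp'R).1
      · exact fallback hρu (hG'off _ hp'R)
  · -- ### the constraints `C i ↦ U i`
    intro i p hpC
    rw [hG'def]
    by_cases hρp : ρ p = 0
    · rw [chartPerturb_of_eq_zero hρp]
      exact hCU i hpC
    · have hpR : p ∈ R := hsuppR (subset_tsupport _ (mem_support.2 hρp))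
      obtain ⟨-, hyU⟩ := hεiP i p ⟨hpC, hRRc hpR⟩ _ ((hsmall p).trans (hεlei i))
      rw [chartPerturb_eq_of_mem_source (hsrcR hpR)]
      exact hyU

end Step

end Literature.Topology.FourManifolds
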